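import Summits.AnomalousDissipation.AnomalousDissipation.Theorems.SawtoothPulseCascadeK1LocalisedCascadeWindowBlockHLog2
import Summits.AnomalousDissipation.AnomalousDissipation.Theorems.SawtoothPulseCascadeK1LocalisedCascadeStripBlockHLog
import Mathlib.Analysis.SpecialFunctions.Log.Basic

/-!
# K1loc, line `Spectral` / thin start — helper: THE LOW-FIBRE-BLOCK H HALF-STEP WITH THE SHARP KERNEL CONSTANTS — ALL KERNEL CONSTANTS SHARP (Log2)

Helper file of the prover lane on the crux `K1LocalisedCascade` (stmt-AnomalousDissipation-19491), route
`SawtoothPulseCascade` (S-D fibre ledger; memo v12 §14 lever (1)).  The H twin of `…StripBlockVLog`: `…StripBlockH.sum_lowFibreBlock_hstep_le`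
with the kernel constants of `…TrapezoidLog` / `…TrapezoidTail`, `A = 4/π + (2/π)·log((p+ΛG)/D) + 1/D + 1/(πD²)`, `τ = 1/(2D)`,
`p = K + Q₂`, `D = ΛG − p`: **`sum_lowFibreBlock_hstep_le_log`** (corollary of `…WindowBlockHLog`, constant plateau).
No definitions; no statement about the crux. [cite: Grafakos2014, Prop. 3.1.2 (5), Prop. 3.2.7 (3), §3.1.3]
[cite: ElgindiLissMattingly2025, §1 (slope ±1 branches)] [problem: turb]

(Log2 variant: the input trapezoid `χ` is also paid by the log bound of `…TrapezoidLog`, i.e. `(Q₁+Q₂)/(Q₂−Q₁)` is replaced by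
`4/π + (2/π)·log((Q₁+Q₂)/(Q₂−Q₁)) + 1/(Q₂−Q₁) + 1/(π(Q₂−Q₁)²)` throughout; built on `…WindowBlockVLog2/HLog2`.)
-/

-- `Summit.<Summit>.<Problem>`: single-conjunct summit, the duplicate namespace segment is deliberate.
set_option linter.dupNamespace false

noncomputable section

namespace Summit.AnomalousDissipation.AnomalousDissipation.Theorems.SawtoothPulseCascade.K1Window

open MeasureTheory Set Filter Topology UnitAddTorus Function Complex Metric
open scoped Real ENNReal
open Literature.Analysis Literature.Analysis.FunctionSpaces Literature.Analysis.FunctionSpaces.Torus Literature.Analysis.FluidPDE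
open Literature.Analysis.FluidPDE.ShearStage
open Literature.Analysis.FluidPDE.SawtoothCascade Literature.Analysis.FluidPDE.SawtoothCascade.CascadeParams
open Summit.AnomalousDissipation.AnomalousDissipation.Theorems.SawtoothPulseCascade.K1Start
open Summit.AnomalousDissipation.AnomalousDissipation.Theorems.SawtoothPulseCascade.K1Flat

/-! ## The low-fibre-block H half-step, sharp kernel constants -/

/-- **THE H HALF-STEP ON A LOW-FIBRE BLOCK, SHARP KERNEL CONSTANTS** (see the file header).
[cite: Grafakos2014, Prop. 3.1.2 (5), Prop. 3.2.7 (3), §3.1.3] -/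
theorem sum_lowFibreBlock_hstep_le_log2 (P : CascadeParams) {G : ℕ} (hγ : P.γ = G) (hδ₀ : 0 < P.δ₀) (hd : 0 < P.d)
    (hN₀ : 1 ≤ P.N₀) (hρN : 1 ≤ P.ρN) (j : ℕ)
    {b : UnitAddTorus (Fin 2) → ℂ} (hb : Continuous b) (hbs : Summable fun k => ‖mFourierCoeff b k‖) (hb1 : ∀ x, ‖b x‖ ≤ 1)
    {K Q₁ Q₂ Λ Λ' : ℕ} (hQ : Q₁ < Q₂) (hΛ : K + Q₂ < Λ * G)
    (W : Finset (Fin 2 → ℤ)) (hW : ∀ k ∈ W, |k 1| < (K : ℤ) ∧ (Λ : ℤ) ≤ |k 0| ∧ |k 0| ≤ Λ')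
    {d₀ M ε₀ : ℝ} (hd₀ : 0 < d₀) (hM : 1 ≤ M) (hMδ : M * P.δ j < π / 2) (hMd : M * P.δ j < π * P.N j * d₀)
    (hAd : 8 * (1 / (2 * (((Λ * G : ℕ) : ℝ) - (K + Q₂ : ℕ)))) ≤
      (4 / π + 2 / π * Real.log ((((K + Q₂ : ℕ) : ℝ) + (Λ * G : ℕ)) / (((Λ * G : ℕ) : ℝ) - (K + Q₂ : ℕ))) +
        1 / (((Λ * G : ℕ) : ℝ) - (K + Q₂ : ℕ)) + 1 / (π * ((((Λ * G : ℕ) : ℝ) - (K + Q₂ : ℕ))) ^ 2)) * d₀)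
    (hε0 : 0 ≤ ε₀)
    (hε : (4 / π + 2 / π * Real.log ((((K + Q₂ : ℕ) : ℝ) + (Λ * G : ℕ)) / (((Λ * G : ℕ) : ℝ) - (K + Q₂ : ℕ))) +
        1 / (((Λ * G : ℕ) : ℝ) - (K + Q₂ : ℕ)) + 1 / (π * ((((Λ * G : ℕ) : ℝ) - (K + Q₂ : ℕ))) ^ 2)) *
      (2 * π * ((Λ' * G : ℕ) : ℝ) * (Real.exp (-(M ^ 2 / 2)) / (2 * P.N j))) ≤ ε₀) :
    ∑ k ∈ W, ‖mFourierCoeff (b ∘ shearMap 0 1 (amp ⟨P.U j, P.U_periodic j, P.contDiff_U (P.δ_pos hδ₀ hd j)⟩ P.γ)) k‖ ^ 2 ≤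
      ((4 / π + 2 / π * Real.log (((Q₁ : ℝ) + Q₂) / ((Q₂ : ℝ) - Q₁)) + 1 / ((Q₂ : ℝ) - Q₁) +
        1 / (π * ((Q₂ : ℝ) - Q₁) ^ 2)) *
          (ε₀ + (4 / π + 2 / π * Real.log ((((K + Q₂ : ℕ) : ℝ) + (Λ * G : ℕ)) / (((Λ * G : ℕ) : ℝ) - (K + Q₂ : ℕ))) +
        1 / (((Λ * G : ℕ) : ℝ) - (K + Q₂ : ℕ)) + 1 / (π * ((((Λ * G : ℕ) : ℝ) - (K + Q₂ : ℕ))) ^ 2)) *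
            Real.sqrt ((2 * P.N j : ℕ) * (4 * d₀))) +
        Real.sqrt (∑' k : Fin 2 → ℤ, (if (Λ : ℤ) ≤ |k 0| ∧ |k 0| ≤ Λ' ∧ (Q₁ : ℤ) < |k 1| then (1 : ℝ) else 0) *
          ‖mFourierCoeff b k‖ ^ 2)) ^ 2 := by
  classical
  -- the lowest-fibre constants, made opaque
  have hpΛ : (((K + Q₂ : ℕ) : ℝ)) < ((Λ * G : ℕ) : ℝ) := by exact_mod_cast hΛ
  generalize hDst : ((Λ * G : ℕ) : ℝ) - (K + Q₂ : ℕ) = Dst at *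
  have hDst0 : 0 < Dst := by rw [← hDst]; linarith
  generalize hRst : (((K + Q₂ : ℕ) : ℝ) + (Λ * G : ℕ)) / Dst = Rst at *
  have hRst1 : 1 ≤ Rst := by
    rw [← hRst, le_div_iff₀ hDst0, ← hDst]
    have : (0 : ℝ) ≤ ((K + Q₂ : ℕ) : ℝ) := Nat.cast_nonneg _
    linarith
  generalize hA : 4 / π + 2 / π * Real.log Rst + 1 / Dst + 1 / (π * Dst ^ 2) = A at *
  have hA0 : 0 ≤ A := by
    have h1 : 0 ≤ Real.log Rst := Real.log_nonneg hRst1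
    rw [← hA]; positivity
  -- the window hypotheses of `…WindowBlockVLog` with the constant plateau `p = K + Q₂`
  have hnat : ∀ k ∈ W, Λ ≤ (k 0).natAbs ∧ (k 0).natAbs ≤ Λ' := fun k hk => by
    obtain ⟨-, h2, h3⟩ := hW k hk
    rw [← Int.natCast_natAbs] at h2 h3
    exact ⟨by exact_mod_cast h2, by exact_mod_cast h3⟩
  have hW' : ∀ k ∈ W, (Λ : ℤ) ≤ |k 0| ∧ |k 0| ≤ Λ' := fun k hk => (hW k hk).2
  have hWp : ∀ k ∈ W, |k 1| + Q₂ ≤ (((fun _ : ℤ => K + Q₂) (k 0) : ℕ) : ℤ) := fun k hk => by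
    have := (hW k hk).1; push_cast; linarith
  have hpG : ∀ k ∈ W, (fun _ : ℤ => K + Q₂) (k 0) < (k 0).natAbs * G := fun k hk =>
    lt_of_lt_of_le hΛ (Nat.mul_le_mul_right _ (hnat k hk).1)
  have hfib : ∀ k ∈ W, (((K + Q₂ : ℕ) : ℝ)) < (((k 0).natAbs * G : ℕ) : ℝ) := fun k hk => by exact_mod_cast hpG k hk
  have hxG : ∀ k ∈ W, ((Λ * G : ℕ) : ℝ) ≤ (((k 0).natAbs * G : ℕ) : ℝ) := fun k hk => by
    exact_mod_cast Nat.mul_le_mul_right _ (hnat k hk).1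
  have hA' : ∀ k ∈ W, 4 / π + 2 / π * Real.log (((((fun _ : ℤ => K + Q₂) (k 0) : ℕ) : ℝ) + ((k 0).natAbs * G : ℕ)) /
        ((((k 0).natAbs * G : ℕ) : ℝ) - ((fun _ : ℤ => K + Q₂) (k 0) : ℕ))) +
        1 / ((((k 0).natAbs * G : ℕ) : ℝ) - ((fun _ : ℤ => K + Q₂) (k 0) : ℕ)) +
        1 / (π * (((((k 0).natAbs * G : ℕ) : ℝ) - ((fun _ : ℤ => K + Q₂) (k 0) : ℕ))) ^ 2) ≤ A := by
    intro k hk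
    simp only
    have hx := hxG k hk
    have hf := hfib k hk
    have hp0 : (0 : ℝ) ≤ ((K + Q₂ : ℕ) : ℝ) := Nat.cast_nonneg _
    -- ratio decreasing in `|n|G`, ramp increasing
    have hratio : (((K + Q₂ : ℕ) : ℝ) + ((k 0).natAbs * G : ℕ)) / ((((k 0).natAbs * G : ℕ) : ℝ) - (K + Q₂ : ℕ)) ≤ Rst := by
      rw [← hRst, ← hDst]
      have h := ratioClass_ratio_le (c₁ := 1) (c₂ := 1) (Q := ((K + Q₂ : ℕ) : ℝ)) hx (by linarith) hp0 zero_le_one one_pos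
      simpa only [one_mul, add_comm] using h
    have hRpos : 0 < (((K + Q₂ : ℕ) : ℝ) + ((k 0).natAbs * G : ℕ)) / ((((k 0).natAbs * G : ℕ) : ℝ) - (K + Q₂ : ℕ)) :=
      div_pos (by linarith only [hp0, hf]) (sub_pos.mpr hf)
    have hlog := Real.log_le_log hRpos hratio
    have hD : Dst ≤ (((k 0).natAbs * G : ℕ) : ℝ) - (K + Q₂ : ℕ) := by rw [← hDst]; linarith only [hx]
    have h2 : 1 / ((((k 0).natAbs * G : ℕ) : ℝ) - (K + Q₂ : ℕ)) ≤ 1 / Dst := one_div_le_one_div_of_le hDst0 hD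
    have h3 : 1 / (π * ((((k 0).natAbs * G : ℕ) : ℝ) - (K + Q₂ : ℕ)) ^ 2) ≤ 1 / (π * Dst ^ 2) :=
      one_div_le_one_div_of_le (by positivity)
        (mul_le_mul_of_nonneg_left (pow_le_pow_left₀ hDst0.le hD 2) Real.pi_pos.le)
    rw [← hA]
    have hπ : 0 < 2 / π := by positivity
    have h1 := mul_le_mul_of_nonneg_left hlog hπ.le
    linarith only [h1, h2, h3]
  have hτ' : ∀ k ∈ W, 1 / (2 * ((((k 0).natAbs * G : ℕ) : ℝ) - ((fun _ : ℤ => K + Q₂) (k 0) : ℕ))) ≤ 1 / (2 * Dst) := by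
    intro k hk
    simp only
    have hD : Dst ≤ (((k 0).natAbs * G : ℕ) : ℝ) - (K + Q₂ : ℕ) := by rw [← hDst]; linarith only [hxG k hk]
    exact one_div_le_one_div_of_le (by positivity) (by linarith only [hD])
  exact sum_windowBlock_hstep_le_log2 P hγ hδ₀ hd hN₀ hρN j hb hbs hb1 hQ (fun _ => K + Q₂) W hW' hWp hpG hd₀ hM hMδ hMd hA0 hA'
    hτ' hAd hε0 hε

end Summit.AnomalousDissipation.AnomalousDissipation.Theorems.SawtoothPulseCascade.K1Window
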